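import Mathlib
import HarnessLib
import HarnessLib.Audit
import Summits.AtomisticToContinuum.Statement
import Literature.Barriers.AtomisticToContinuum.MacroErgodicityHypothesis
import Literature.Barriers.AtomisticToContinuum.FixedLengthNoConductivityControl
import Literature.MathematicalPhysics.KineticTheory.LangevinChainNESSHolds
import Summits.AtomisticToContinuum.FouriersLaw.Theorems.EmbeddedDrudeMourreNessUnique
import Summits.AtomisticToContinuum.FouriersLaw.Theorems.FourierGreenKuboFourierFiniteResponseOfUnique

/-!
Route: LiouvilleLadder

CLOSED (retired) 2026-08-15T13:44:15Z by operator:999:1257524 — reason: not-a-thesis: assembly does not conclude the sub-problem Statement — note: D-0027 §2.1 audit (human 2026-08-15: routes that do not decide the summit are removed): the assembly concludes `Literature.MathematicalPhysics.KineticTheory.HeatConduction.FouriersLaw`, not the sub-problem statement; a NEW conforming route may be opened from the same idea (generated `closes : … → _r. The file is kept as the record of this route; refuted decls are indexed as negative knowledge (`ledger negatives`).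

# Route LiouvilleLadder — Fourier's law as the degree-one Liouville theorem of the thermal chain — κ
= −current/slope on the plane of linear-growth stationary perturbations

X_Λ (LIOUVILLE LADDER; realises idea card
AtomisticToContinuum/FouriersLaw/liouville-ladder-linear-growth-kappa). Grade the
stationary FIRST-ORDER PERTURBATIONS ν of the Gibbs state μ_T of the INFINITE pinned chain
pinnedChain ω₂ lam β γ (ω₂, lam, β > 0) —
linear functionals on local observables with ν(𝒜f) = 0 for local test f (𝒜 = liouvilleZ) — by
GROWTH: 𝓗_k = those with
|ν(f)| ≤ C(1+|a|)^k ‖f‖_{L²(μ_T)} for f a C¹ function of the box {a,…,a+n}. It suffices to show X_Λ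
= X_∞ ∧ X_N with
X_∞ (infinite volume, the storey where κ lives): PlaneLiouville — dim 𝓗_1(ℤ) ≤ 2 (the plane of the
temperature shift ν_sh and the
McLennan state ν_1), and SlopeCurrentLaw — on 𝓗_1 the bond current is −κ(T) × (kinetic-temperature
slope) with κ(T) > 0, the slope
being attained; and X_N (their finite-N shadow in the Bonetto–Lebowitz–Rey-Bellet order of limits, δ
→ 0 at fixed N first, along the
unique weak steady states, θ_N(i) = ∂_δ μ_{N,T+δ/2,T−δ/2}(p_i²), g_N = D_N/(N−1)):
LocalFourierEquality — in the bulk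
θ_N(i+1) − θ_N(i) = −g_N/κ(T) up to ε(|g_N| + 1/(N−1)) beyond b(ε) sites from the baths;
KapitzaBound — within b sites of a bath θ_N stays
within C_b(|g_N| + 1/(N−1)) of ±1/2; TopScaleBound — χ²(μ_{N,T+δ/2,T−δ/2} ‖ μ_{N,T,T}) ≤ C(N+1)δ²
near δ = 0 (the a-priori estimate that
starts the excess-decay iteration); with the shared finite-N infrastructure NessUnique (stmt-0741),
FiniteResponseOfUnique (stmt-0717),
FiniteResponseProfile (stmt-2742). Telescoping the bulk law between the two contact layers gives
(N−1−2b)g_N/κ(T) → 1, i.e.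
D_N → κ(T) ∈ (0,∞) for every steady-state family; clause (i) is the PROVED fact
pinnedChain_exists_isSteadyState + NessUnique.
Lean: `NessUnique ∧ FiniteResponseOfUnique ∧ FiniteResponseProfile ∧ TopScaleBound ∧ PlaneLiouville
∧ SlopeCurrentLaw ∧ KapitzaBound ∧ LocalFourierEquality`

## Assembly
Glue (elementary real analysis, est. 200–300 Lean lines; provers import the three modules listed in
the front-matter): fix parameters > 0;
clause (i) of FouriersLawFor from the PROVED fact
Literature.MathematicalPhysics.KineticTheory.HeatConduction.pinnedChain_exists_isSteadyState
(all N) + NessUnique. For clause (ii) build the canonical family μ* by Classical.choose (any measure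
where a temperature is ≤ 0); for T > 0
take κ(T) > 0 from LocalFourierEquality at (μ*, T) (κ(T) := 1 for T ≤ 0). Given any steady-state
family μ, by NessUnique μ_{N,T+δ/2,T−δ/2} =
μ*_{N,T+δ/2,T−δ/2} for |δ| < 2T, so all difference quotients agree eventually in 𝓝[≠]0
(Filter.Tendsto.congr', as in
hasBoundedResponse_iff_of_unique); FiniteResponseOfUnique gives D : ℕ → ℝ, FiniteResponseProfile
gives θ_N : Fin N → ℝ. For ε > 0 take
b, N₀ from LocalFourierEquality and C_b, N₀' from KapitzaBound; for N ≥ max(N₀, N₀', 2b+3) telescope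
over the m = N−1−2b bulk bonds:
θ_N(N−1−b) − θ_N(b) = −m D_N/((N−1)κ) + E with |E| ≤ mε(|D_N|+1)/(N−1) ≤ ε(|D_N|+1), while
KapitzaBound gives θ_N(b) = 1/2 + r₁,
θ_N(N−1−b) = −1/2 + r₂, |r_i| ≤ C_b(|D_N|+1)/(N−1). Hence with a_N = m/((N−1)κ) → 1/κ: |a_N D_N − 1|
≤ (ε + 2C_b/(N−1))(|D_N| + 1), which
first bounds |D_N| (take ε < 1/(4κ)) and then gives limsup |D_N/κ − 1| ≤ c·ε; ε ↓ 0 yields D_N →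
κ(T). TopScaleBound, PlaneLiouville and
SlopeCurrentLaw are carried as antecedents: they are the mechanism behind LocalFourierEquality /
KapitzaBound (foreseen glued splits below)
and are formally unused by this glue until those splits are filed (declared; same convention as
LocalOhmRigidity's ZeroCurrentRigidity).

Rationale: WHY THIS LINE. The mechanism is a transplant from elliptic homogenization with an explicit
dictionary: a-harmonic function ↦ stationary first-order
perturbation ν (ν∘𝒜 = 0); affine functions ↦ the model plane span{ν_sh, ν_1}; homogenized matrix ā ↦
κ; first-order corrector ↦ the
time-integrated current (McLennan) corrector W_odd = −(s/T²)lim_{η↓0}(η+𝒜)⁻¹Σ_y j_y; "linear-growth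
a-harmonic = affine + corrector, a
(d+1)-dimensional space" (AvellanedaLin1987 Thm on polynomial growth; arXiv:1409.2678;
ArmstrongKuusiMourrat2019 Ch. 3; half-space:
doi:10.1137/16m1070384) ↦ PlaneLiouville; boundary Lipschitz estimate ↦ KapitzaBound; large-scale
C^{1,α} by EXCESS DECAY ↦
LocalFourierEquality (and, later, rates). The identity ν_lin(𝒜f) = −(s/T²)Cov_T(f, Σ_y j_y) ("slope
forces current") is McLennan's
first-order steady ensemble (Mclennan1959; rigorous form MaesNetocny2010): a stationary perturbation
with a temperature slope exists iff
the Green–Kubo corrector exists, and then current/slope = −κ_GK (BonettoLebowitzReyBellet2000 §7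
(37)), so κ_BLR = κ_GK is built in
rather than a separate thermodynamic-limit crux (route FourierGreenKubo, stmt-0742) and no
time-decay rate, spectral gap
(BeckerMenegaki2022) or sector condition (Bernardin2014 §2) is invoked — only stationary,
zero-frequency objects. Against the sibling
route LocalOhmRigidity (LocalOhm INEQUALITY × BV profile ⇒ bounded response, convergence imported)
this line states the local law WITH
EQUALITY and a named κ, which telescopes directly to D_N → κ; against the negatives index (empty)
nothing is re-asked.

RANKED CRUXES. #2 PlaneLiouville (crux) — (Λ₁ CLASSIFICATION — the wall; card crux 1
'HydrostaticRigidity' in Liouville form.) For ω₂, lam, β > 0 (γ inert), T > 0 and any DLR Gibbs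
state μ of the infinite pinned chain at temperature T: any THREE functionals ν₀, ν₁, ν₂ on
observables of the infinite chain which are (a) linear, (b) stationary to first order — ν(liouvilleZ
f) = 0 for every local test function f (C¹, bounded, bounded derivative; decl IsLocalTestFunction) —
and (c) of LINEAR GROWTH — for every box length n there is C_n with |ν(g ∘ boxRestrictAt a n)| ≤ C_n
(1 + |a|) ‖g ∘ boxRestrictAt a n‖_{L²(μ)} for all a ∈ ℤ and all C¹ maps g with g∘box
square-integrable — are linearly dependent on local test functions. I.e. the space 𝓗_1(ℤ) of
linear-growth stationary first-order perturbations of μ_T has dimension ≤ 2; its two known members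
are the temperature shift ν_sh(f) = Σ_y Cov_T(f, h_y)/T² (bounded) and, when the Green–Kubo
corrector exists, the McLennan state ν_1 = linear temperature profile + odd corrector (growth
exactly 1). Dictionary: linear-growth a-harmonic functions on ℝ are affine (+corrector): a
2-dimensional space. Consequences: 𝓗_0(ℤ) ⊆ span and no bounded perturbation carries current
(linearised odd macro-ergodicity), no hidden charge, uniqueness one storey above the filed rigidity
statements. [difficulty: open-problem] (why it might fail: A third independent member of 𝓗₁: a
hidden (quasi-)local conserved charge (Mazur) or a second Gibbs state at the same T adds a bounded
one; KAM/breather families might leave L²-regular 'invisible' stationary perturbations; no such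
classification is proved for any anharmonic chain.) [AvellanedaLin1987, arXiv:1409.2678,
ArmstrongKuusiMourrat2019, doi:10.1137/16m1070384, FritzFunakiLebowitz1994, Bernardin2014,
SpohnLebowitz1977, Mazur1969]
#3 SlopeCurrentLaw (crux) — (Λ₁ CONSTITUTIVE LAW ON THE PLANE; card 'LadderAlgebra' +
'(Λ₁)-existence ⟺ Green–Kubo' + 'κ = −current/slope'.) For ω₂, lam, β > 0, T > 0 and any Gibbs state
μ at T there is κ = κ(T) > 0 such that (i) for EVERY linear, first-order-stationary, linear-growth
functional ν (same three hypotheses as PlaneLiouville) the bond current equals −κ times the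
kinetic-temperature slope: ν(j_0) = −κ (ν(p_1²) − ν(p_0²)), j_0 = bondCurrentZ σ 0; and (ii) SOME
such ν has ν(p_1²) ≠ ν(p_0²). Since ν∘shift is again in the class and ν(j_x) = ν(j_0) (stationarity
against the site energies), (i) makes the kinetic profile x ↦ ν(p_x²) of every ν ∈ 𝓗_1 exactly
affine with slope −ν(j_0)/κ; (i) restricted to zero slope is 'no current without a temperature
slope' on 𝓗_1 (odd rigidity one storey up; false at lam = β = 0: SpohnLebowitz1977 current-carrying
states); (ii) is existence of the McLennan–Zubarev first-order state ν_1 = ν_lin + W_odd, equivalent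
to existence of the time-integrated current corrector in local L²(μ_T) (Abelian, observable-wise
Green–Kubo), and then κ = −ν_1(j_0)/slope = κ_GK(T) (BLR (37)): κ_BLR = κ_GK is built into the
plane. [difficulty: open-problem] (why it might fail: (ii) = McLennan corrector in local L² ⟺
space-time summability of current–observable correlations (Abelian Green–Kubo), open for every
deterministic anharmonic lattice (κ_GK ~ (lam T)⁻² as T→0); (i) with one κ also needs 'no current
without slope' on 𝓗₁, a storey above ZeroCurrentRigidity.) [Mclennan1959, MaesNetocny2010,
BonettoLebowitzReyBellet2000, Bernardin2014, KunduDharNarayan2009, AokiLukkarinenSpohn2006,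
SpohnLebowitz1977]
#4 LocalFourierEquality (crux) — (FINITE-N SHADOW OF Λ₁ — the bulk law WITH EQUALITY; output of the
excess-decay engine, card crux 3.) For pinnedChain ω₂ lam β γ (all four > 0), under weak-NESS
uniqueness, along any steady-state family μ_{N,T_L,T_R} and every T > 0 there is κ = κ(T) > 0 such
that for every ε > 0 there are a contact depth b and N₀ with: for all N ≥ N₀, every response
coefficient d = D_N = lim_{δ→0} totalCurrent(μ_{N,T+δ/2,T−δ/2})/δ and every kinetic-temperature
response profile θ(i) = lim_{δ→0} (μ_{N,T+δ/2,T−δ/2}(p_i²) − μ_{N,T,T}(p_i²))/δ, at every BULK bond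
(i, i+1) with b ≤ i ≤ N−2−b: |θ(i+1) − θ(i) + d/((N−1)κ)| ≤ ε (|d| + 1)/(N−1). In words: g_N =
D_N/(N−1) being the per-bond current response, the profile increments equal −g_N/κ up to a relative
error that is uniform over the bulk and → 0 as the excluded contact depth grows — Fourier's law j =
−κ∇T holding locally, with equality and one κ, in linear response. Mechanism (layer 2, declared):
normalised recentred responses (W_N − θ_N(x)·shift)/g_N on bulk windows are precompact under
N-uniform growth bounds (from TopScaleBound by excess decay) and every limit lies in 𝓗_1(ℤ) with
unit current, so SlopeCurrentLaw forces increments → −1/κ (compactness–contradiction à la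
Avellaneda–Lin). False at lam = β = 0 (RiederLebowitzLieb1967: flat bulk, g_N = O(1)). Stronger than
LocalOhmRigidity.LocalOhm (inequality, window sums). [deps: PlaneLiouville, SlopeCurrentLaw,
TopScaleBound] [difficulty: XL] (why it might fail: No interior a-priori (Caccioppoli) estimate
exists for a pure-transport bulk, so window limits may not exist or may leave 𝓗₁; bulk increments
could stay non-uniform (k = π staggering, mean free path ~(lam T)⁻² ≫ b) or D_N could vanish to
higher order; false at lam = β = 0 (flat bulk, g_N = O(1)).) [BonettoLebowitzReyBellet2000,
AvellanedaLin1987, ArmstrongKuusiMourrat2019, AokiKusnezov2000, LepriLiviPoliti2003, Dhar2008,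
RiederLebowitzLieb1967]
#5 TopScaleBound (crux) — (TOP-SCALE A-PRIORI ESTIMATE; card crux 2.) For pinnedChain (all four
parameters > 0), under weak-NESS uniqueness, along any steady-state family and every T > 0 there is
C with: for every N, for all δ ≠ 0 small enough (depending on N), μ_{N,T+δ/2,T−δ/2} ≪ μ_{N,T,T} and
∫ (dμ_{N,T+δ/2,T−δ/2}/dμ_{N,T,T})² dμ_{N,T,T} ≤ 1 + C(N+1)δ² — i.e. χ²(NESS_δ ‖ NESS_0) = O(δ²N):
the NESS is EXTENSIVELY (not super-extensively) distinguishable from equilibrium to second order,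
equivalently the linear-response density W_N = ∂_δ(dμ_δ/dμ_0)|₀ has ‖W_N‖²_{L²(μ_{N,T,T})} ≤ C(N+1).
Stated junk-free with the lower Lebesgue integral of rnDeriv². Local equilibrium predicts χ² ≈ δ²
Σ_i θ_N(i)² c_v/T² ≍ δ²N with an odd (current) part O(δ²/N). Role: the a-priori bound at scale N
from which excess decay propagates O(g_N)-accuracy down to windows of size R₀ (layer 2: growth
bounds for LocalFourierEquality and KapitzaBound). N = 0, 1: both states coincide (point mass;
single site thermalised at (T_L+T_R)/2 = T), χ² = 0. [difficulty: L] (why it might fail: Provability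
rather than truth: at fixed N the only a-priori control is entropy production O(δ²) with no
N-uniform Poincaré constant behind it (spectral gap ≲ γ/N, BeckerMenegaki2022); a proof needs
one-body marginals within O(δ) of Gibbs uniformly in N (an LTE statement), itself open.)
[EckmannPilletReyBellet1999b, BeckerMenegaki2022, CuneoEckmannHairerReyBellet2018, HairerMajda2009,
BonettoLebowitzReyBellet2000]
#6 KapitzaBound (crux) — (CONTACT LAYERS = BOUNDARY REGULARITY; the (Λ₀/Λ₁, half-line) rungs in
finite-N form.) For pinnedChain (all four > 0), under weak-NESS uniqueness, along any steady-state
family, every T > 0 and every contact depth b there are C = C_b and N₀ such that for all N ≥ N₀,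
every response coefficient d = D_N and kinetic response profile θ (as in LocalFourierEquality):
|θ(i) − 1/2| ≤ C(|d| + 1)/(N−1) for the sites i ≤ b, and |θ(i) + 1/2| ≤ C(|d| + 1)/(N−1) for the
sites i ≥ N−1−b. In words: the first/last b+1 kinetic temperatures sit within O(current + 1/N) of
the bath perturbations ±1/2 — a bounded Kapitza (contact) resistance plus bounded growth across the
contact layer. At the bath sites this is the exact identity γ(1/2 − θ(0)) = g_N = γ(θ(N−1) + 1/2)
(energy balance J = γ(T_L − ⟨p_0²⟩), EckmannPilletReyBellet1999b/BLR (25)–(27), differentiated at δ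
= 0); across the layer it is the boundary analogue of the growth bounds (dictionary: Avellaneda–Lin
boundary Lipschitz estimate; mechanism: 𝓗_0(ℕ, bath) = 0 and 𝓗_1(ℕ, bath) one-dimensional — the
single-thermostat rung — plus compactness). Holds trivially in the ballistic corner (θ bounded, g_N
= O(1)); its content is for g_N → 0. [deps: TopScaleBound] [difficulty: L] (why it might fail:
Contact layers have width ~ mean free path ~(lam T)⁻² and the kinetic temperature near a Langevin
bath deviates from other local temperatures (AokiKusnezov2001 boundary jumps); a finite but huge C_b
at low T is fine, an N-growing contact deviation (anomalous contact resistance) is not.)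
[AokiKusnezov2001, LepriLiviPoliti2003, Dhar2008, EckmannPilletReyBellet1999b,
doi:10.1137/16m1070384]
#9 NessUnique (support) — (shared item stmt-AtomisticToContinuum-0741, routes FourierGreenKubo /
LocalOhmRigidity / FeketeResistance.) Uniqueness of the weak steady state (IsSteadyState class) of
pinnedChain ω₂ lam β γ (all > 0) for every N and T_L, T_R > 0; with the PROVED existence fact
pinnedChain_exists_isSteadyState it is clause (i) of FouriersLawFor and it makes the steady-state
family canonical. [difficulty: L] [CuneoEckmannHairerReyBellet2018, BonettoLebowitzReyBellet2000]
#9 FiniteResponseOfUnique (support) — (shared item stmt-AtomisticToContinuum-0717.) Under weak-NESS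
uniqueness the finite-N linear-response limit D_N(T) = lim_{δ→0,δ≠0}
totalCurrent(μ_{N,T+δ/2,T−δ/2})/δ exists for every steady-state family, T > 0 and N
(differentiability at equilibrium of NESS expectations of the polynomial currents; HairerMajda2009
framework, ReyBellet2003 Rem. 4.4). [difficulty: L] [HairerMajda2009, ReyBellet2003,
CuneoEckmannHairerReyBellet2018]
#9 FiniteResponseProfile (support) — (shared item stmt-AtomisticToContinuum-2742.) Under weak-NESS
uniqueness, for every steady-state family, T > 0, N and site i the kinetic-temperature response
θ_N(i) = lim_{δ→0} (μ_{N,T+δ/2,T−δ/2}(p_i²) − μ_{N,T,T}(p_i²))/δ exists (same differentiability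
content for the observable p_i²). Needed to instantiate θ in LocalFourierEquality and KapitzaBound.
[difficulty: L] [HairerMajda2009, ReyBellet2003, BonettoLebowitzReyBellet2000]

TWO-LAYER PLAN. Foreseen glued splits (nothing filed now; k ≤ 3, depth 1): LocalFourierEquality ⇐
BulkGrowthBounds → PlaneCapture → LocalFourierEquality,
where BulkGrowthBounds = "on every bulk window of radius R₀ ≤ R ≤ dist-to-bath the response W_N is
within O(g_N·R) (local L²(μ)) of a
temperature shift" (from TopScaleBound by excess decay Exc(θR) ≤ ½Exc(R), Campanato iteration from
scale N down to R₀) and PlaneCapture =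
"every local limit of (W_N − θ_N(x)ν_sh)/g_N recentred at bulk sites lies in 𝓗_1(ℤ) with unit
current" (compactness + SlopeCurrentLaw ⇒
increments → −1/κ). KapitzaBound ⇐ HalfLineLiouville (𝓗_0(ℕ, bath) = 0, 𝓗_1(ℕ, bath) = ℝ·ν_1⁺; needs
definition D2) → ContactGrowth →
KapitzaBound. SlopeCurrentLaw ⇐ McLennanState (Abelian space-time summability of current–observable
correlations ⇒ ν_1 ∈ 𝓗_1 with
ν_1(j_0) = −s κ_GK; theorem-grade given the summability, MaesNetocny2010 form) → OddPlaneRigidity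
(ν(j_0) = 0 for every ν ∈ 𝓗_1 of zero
slope) → SlopeCurrentLaw. Strengthening child once PlaneLiouville closes: LocalFourierRate, |θ(i+1)
− θ(i) + g_N/κ| ≤ C|g_N|·dist(i, baths)^{−α}
(rates for D_N − κ by the same iteration; the card's quantitative claim, deliberately not filed at
open).

KILL CRITERIA. (a) A third independent element of 𝓗_1(ℤ) at some (ω₂, lam, β) > 0 refutes
PlaneLiouville: if it is bounded and carries current (hidden
conserved charge overlapping J; e.g. the Yamilov integrability conditions holding somewhere, cf.
LocalOhmRigidity.NoLocalIntegrals) then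
SlopeCurrentLaw dies too, Mazur1969_inequality makes Green–Kubo diverge and the line closes
`refuted:PlaneLiouville` (and the conjunct
itself becomes a refutation target there); if it comes from a second Gibbs state, pivot: restate
modulo Gibbs non-uniqueness. (b) Certified
numerics or a theorem showing bulk increments of θ_N/g_N that do not become uniform (persistent k =
π staggering, window dependence, or
|D_N| → 0) refutes LocalFourierEquality → close `refuted:LocalFourierEquality`. (c) ‖W_N‖² growing
faster than N refutes TopScaleBound
→ pivot, restate with the observed power (the ladder survives with a weaker starting estimate); (d)
an N-growing contact deviation refutes
KapitzaBound → pivot to a contact-renormalised telescoping (drop the first o(N) sites). (e)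
Refutation of NessUnique kills clause (i) for
every route. Mooted (superseded) if FourierGreenKubo's GreenKubo (0703) and ThermodynamicLimit
(0742) both close; this route would still
deliver the profile law and the identification κ_BLR = κ_GK.

NOT DECOMPOSED YET. The compactness glue behind LocalFourierEquality/KapitzaBound (topology = local
weak-L²(μ_T) on windows; passage of first-order stationarity
to limits; finite-volume equilibrium marginals → μ_T, which needs existence, uniqueness and decay of
correlations of the 1-D Gibbs state —
InfiniteVolumeSetup stmt-0743 plus a clustering fact not in Literature); the excess functional Exc
and the Campanato iteration (rates); the
half-line-with-one-bath linearised generator and its Λ₀/Λ₁ rungs (single-thermostat card) behind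
KapitzaBound; the LadderAlgebra
identities (ν_sh ∈ 𝓗_0; ν_lin(𝒜f) = −(s/T²)Cov_T(f, Σ_y j_y); McLennan corrector; harmonic
counterexamples) — provers attach them with
`--supports SlopeCurrentLaw`; the T-dependence of b(ε), C_b, R₀ (allowed to blow up like the mean
free path (lam T)⁻² as T → 0). All are
layer-2 children or supports, filed only after a crux closes (D-0019).

CHEAPEST FALSIFIER. Linear-response numerics for pinnedChain with ω₂ = lam = β = γ = 1 at T = 1 and
T = 0.1, N = 32, 64, 128, 256 (NEMD with small δ, or a
deterministic solver of the linearised Fokker–Planck equation / the tensor-train card): (i) the bulk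
increments (θ_N(i+1) − θ_N(i))/g_N must
collapse onto one constant −1/κ(T), uniformly beyond a fixed depth b from the baths and stably in N
— persistent staggering, window
dependence or drift in N kills LocalFourierEquality (and calibrates κ(1) otherwise); (ii) (θ_N(i) −
1/2)/g_N bounded near the left bath
uniformly in N — growth kills KapitzaBound; (iii) χ²(NESS_δ‖NESS_0)/δ² = ‖W_N‖² versus N —
superlinear growth kills TopScaleBound as
stated. Not run by this planner (kit outside the plancard budget; recorded for refuters). Exact
check available at lam = β = 0 from the
RiederLebowitzLieb1967 covariances: (i) fails there (flat bulk with g_N = O(1)), as every crux must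
since all carry 0 < lam, 0 < β.

NUMBERS. Ballistic corner lam = β = 0: J_N independent of N, D_N ≍ N, flat bulk profile with
exponentially thin boundary layers (RiederLebowitzLieb1967;
HarmonicChainBallisticFlux.not_hasBoundedResponse). Low temperature: κ(T) ∼ (lam T)⁻² predicted
(AokiLukkarinenSpohn2006 (3.25)–(3.28),
LowTemperatureWeakAnharmonicity scaling conjugacy proved), so b(ε), C_b, R₀ ∼ mean free path ∼ (lam
T)⁻². Spectral gap of the N-chain
≤ Cγ/N (BeckerMenegaki2022) — unused here. Boundary temperature jumps ∝ J with an O(1) contact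
resistance in φ⁴/FPU-β numerics
(AokiKusnezov2001). Finite-size conductivity fits κ(N) = κ/(1 + aℓ/N) (AokiKusnezov2000,
LepriLiviPoliti2003 §6) = the rate the
LocalFourierRate child should explain.

DEFINITION REQUESTS. D1 `StationaryPerturbationClass` (topic
Literature/MathematicalPhysics/KineticTheory): for P : OscillatorChain, μ : Measure ChainConfig,
k : ℕ — the predicate "ν : (ChainConfig → ℝ) → ℝ is linear, ν(P.liouvilleZ f) = 0 for
IsLocalTestFunction f, and
|ν(g ∘ boxRestrictAt a n)| ≤ C_n(1+|a|)^k‖g∘box‖_{L²(μ)} for C¹ g" (= the hypothesis block inlined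
three times in PlaneLiouville /
SlopeCurrentLaw; also serves cards single-thermostat-rigidity and
conservation-law-rigidity-local-ohm). D2 `halfLineBathLiouville`: the
linearised generator of the half-line chain (sites ℕ) with one Langevin bath at site 0 at
temperature T, acting on local observables —
for the Λ₀/Λ₁ half-line rungs behind KapitzaBound (not filed as items now). Cite-fact wanted:
uniqueness + exponential decay of
correlations of the DLR state of chainSpecification (pinnedChain …) T (1-D, finite range,
superstable; transfer-operator proof) in
Literature/Probability/LatticeModels — needed by every layer-2 compactness glue.

Novelty: Searches (2026-08-15): `lit frontier AtomisticToContinuum --since 2020` (30 rows: quantitative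
homogenization of particle systems only for
reversible exclusion doi:10.1002/cpa.70034 = arXiv:2404.12234 and mobility learning
arXiv:2603.05089; deterministic frontier
CanestrariLiveraniOlla2026 = arXiv:2310.13338); `lit bridges AtomisticToContinuum --cross any` (30
rows; no homogenization-regularity ↔
oscillator-chain bridge); `lit search --source crossref` ×5: "McLennan statistical mechanics of the
steady state" (doi:10.1103/physrev.115.1405;
Sano 2017 doi:10.1016/j.physa.2017.01.049), "Rigorous meaning of McLennan ensembles"
(doi:10.1063/1.3274819), "large-scale regularity
interacting particle systems Liouville" (8 rows, only elliptic: doi:10.1137/16m1070384), "Avellaneda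
Lin compactness methods"
(doi:10.1002/cpa.3160400607, doi:10.1002/cpa.3160420203), "boundary temperature jumps Fourier law
anharmonic chain" (doi:10.1103/physrevlett.86.4029,
doi:10.1103/physreve.70.051203); `lit galaxy search "McLennan ensemble" --star all` and `…
"Liouville theorem stationary measures chain of
oscillators" --star all` (service saturated this hour: 0 rows, logged); local index / OpenAlex /
arXiv endpoints unavailable this hour
(logged in NOTES). Plus the card's searches (frontier, crossref ×4, grep of the 57 sub cards) and
the refuter novelty audit of the card
(McLennan/Zubarev, Liggett 1973, Funaki–Spohn 1997, Armstrong–Wu 2022, Giunti–Gu–Mourrat named as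
the Λ₀-storey and reversible preceden  [refs: 10.1002/cpa.70034, 10.1103/physrev.115.1405, 10.1016/j.physa.2017.01.049, 10.1063/1.3274819, 10.1137/16m1070384, 10.1002/cpa.3160400607, 10.1002/cpa.3160420203, 10.1103/physrevlett.86.4029, 10.1103/physreve.70.051203, 2404.12234, 2603.05089, 2310.13338, 1409.2678, doi:10.1002/cpa.70034, doi:10.1103/physrev.115.1405, doi:10.1016/j.physa.2017.01.049, doi:10.1063/1.3274819, doi:10.1137/16m1070384, do]

Barriers (technique_class: liouville-classification excess-decay large-scale-regularity): - technique_class: liouville-classification excess-decay large-scale-regularity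
- Literature.Barriers.AtomisticToContinuum.VelocityReversalBarrier: APPLIES to PlaneLiouville /
SlopeCurrentLaw and is NOT evaded (repair audit 2026-08-15): their class of stationary first-order
perturbations of an R-invariant Gibbs state is closed under momentum reversal R (𝒜(f∘R) = −(𝒜f)∘R;
kernels, test class, L²-bounds R-invariant), R fixes kinetic profiles and negates currents — the
linearised form of the catalogued kernel 'a reversal-closed hypothesis class transports
reversibility to the derived law' — so SlopeCurrentLaw (i)∧(ii) is contradictory and
PlaneLiouville's dimension count fails; the finite-N items evade it because the steady-state class
of L = 𝒜 + γS is not reversal-closed (S R-even, 𝒜 R-odd) and NESS uniqueness selects the retarded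
branch. Recommended repair (prepared, pending tenure): drop both, keep the finite-N ladder.
- Literature.Barriers.AtomisticToContinuum.MacroErgodicityBarrier: APPLIES IN SUBSTANCE (via
MacroErgodicityHypothesis) to PlaneLiouville / SlopeCurrentLaw — they are the stationary,
linearised, zero-frequency shadow of 'regular space-time invariant states are Gibbs mixtures', one
storey up (linear growth); it does not evade; the bet is that the first-order shadow needs no
relative-entropy method, no sector condition (the barrier's formal kernel — A g = 0 from vanishing
Dirichlet form — is never invoked: no fluctuation–dissipation decomposition is attempted) an

History (route lifecycle, newest last):
- 2026-08-15T13:44:15Z · CLOSED retired — not-a-thesis: assembly does not conclude the sub-problem Statement (operator:999:1257524)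

sub-problem: FouriersLaw · status: closed(retired) · opened planner-plancard-AtomisticToContinuum-Fourier-ad75f4a7-0 2026-08-15T11:33:27Z · rev 1 · ledger route-AtomisticToContinuum-LiouvilleLadder
GENERATED by the gate from the ledger (D-0016/17). Provers cite these decls: `theorem foo : Summit.AtomisticToContinuum.FouriersLaw.Theses.LiouvilleLadder.<Decl> := …` in Summits/AtomisticToContinuum/FouriersLaw/Theorems/<Name>.lean.
-/

namespace Summit.AtomisticToContinuum.FouriersLaw.Theses.LiouvilleLadder

open scoped BigOperators Topology Manifold Classical MeasureTheory ProbabilityTheory Matrix InnerProductSpace ComplexConjugate ContinuousMap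
open Filter Set Function TopologicalSpace MeasureTheory

attribute [summit_statement] _root_.FouriersLaw

/-- item stmt-AtomisticToContinuum-4427 · crux · rank 2 · closed · moot by None · by planner
why it might fail: FALSE IN SUBSTANCE (evidence attached): the class contains E_μ (Gibbs ⇒ generator-stationary, C = 1), the equilibrium directions E_{μ_T′} (T′ near T) and ∂_T^m E_μ — already infinite-dimensional — and with any current-carrying ν also ν∘R (momentum reversal): 'any three dependent' fails.
sources: AvellanedaLin1987, arXiv:1409.2678, ArmstrongKuusiMourrat2019, doi:10.1137/16m1070384, FritzFunakiLebowitz1994, Bernardin2014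
[crux] (Λ₁ CLASSIFICATION — the wall; card crux 1 'HydrostaticRigidity' in Liouville form.) For ω₂,
lam, β > 0 (γ inert), T > 0 and any DLR Gibbs state μ of the infinite pinned chain at temperature T:
any THREE functionals ν₀, ν₁, ν₂ on observables of the infinite chain which are (a) linear, (b)
stationary to first order — ν(liouvilleZ f) = 0 for every local test function f (C¹, bounded,
bounded derivative; decl IsLocalTestFunction) — and (c) of LINEAR GROWTH — for every box length n
there is C_n with |ν(g ∘ boxRestrictAt a n)| ≤ C_n (1 + |a|) ‖g ∘ boxRestrictAt a n‖_{L²(μ)} for all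
a ∈ ℤ and all C¹ maps g with g∘box square-integrable — are linearly dependent on local test
functions. I.e. the space 𝓗_1(ℤ) of linear-growth stationary first-order perturbations of μ_T has
dimension ≤ 2; its two known members are the temperature shift ν_sh(f) = Σ_y Cov_T(f, h_y)/T²
(bounded) and, when the Green–Kubo corrector exists, the McLennan state ν_1 = linear temperature
profile + odd corrector (growth exactly 1). Dictionary: linear-growth a-harmonic functions on ℝ are
affine (+corrector): a 2-dimensional space. Consequences: 𝓗_0(ℤ) ⊆ span and no bounded perturbation
carries current (linearised o -/
@[route_item "route-AtomisticToContinuum-LiouvilleLadder"]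
def PlaneLiouville : Prop :=
  ∀ ω₂ lam β γ : ℝ, 0 < ω₂ → 0 < lam → 0 < β → ∀ T : ℝ, 0 < T → ∀ μ : MeasureTheory.Measure Literature.MathematicalPhysics.KineticTheory.HeatConduction.ChainConfig, (Literature.MathematicalPhysics.KineticTheory.HeatConduction.pinnedChain ω₂ lam β γ).IsChainGibbsMeasure T μ → ∀ ν : Fin 3 → ((Literature.MathematicalPhysics.KineticTheory.HeatConduction.ChainConfig → ℝ) → ℝ), (∀ k : Fin 3, (∀ (f g : Literature.MathematicalPhysics.KineticTheory.HeatConduction.ChainConfig → ℝ) (a b : ℝ), ν k (fun σ => a * f σ + b * g σ) = a * ν k f + b * ν k g) ∧ (∀ f : Literature.MathematicalPhysics.KineticTheory.HeatConduction.ChainConfig → ℝ, Literature.Barriers.AtomisticToContinuum.HeatConduction.IsLocalTestFunction f → ν k ((Literature.MathematicalPhysics.KineticTheory.HeatConduction.pinnedChain ω₂ lam β γ).liouvilleZ f) = 0) ∧ (∀ n : ℕ, ∃ C : ℝ, ∀ (a : ℤ) (g : (Fin (n + 1) → ℝ × ℝ) → ℝ), ContDiff ℝ 1 g → MeasureTheory.Integrable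 (fun σ => (g (Literature.Barriers.AtomisticToContinuum.HeatConduction.boxRestrictAt a n σ)) ^ 2) μ → |ν k (g ∘ Literature.Barriers.AtomisticToContinuum.HeatConduction.boxRestrictAt a n)| ≤ C * (1 + |(a : ℝ)|) * Real.sqrt (∫ σ, (g (Literature.Barriers.AtomisticToContinuum.HeatConduction.boxRestrictAt a n σ)) ^ 2 ∂μ))) → ∃ c : Fin 3 → ℝ, c ≠ 0 ∧ ∀ f : Literature.MathematicalPhysics.KineticTheory.HeatConduction.ChainConfig → ℝ, Literature.Barriers.AtomisticToContinuum.HeatConduction.IsLocalTestFunction f → ∑ k : Fin 3, c k * ν k f = 0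

/-- item stmt-AtomisticToContinuum-4428 · crux · rank 3 · closed · moot by None · by planner
why it might fail: REFUTABLE (evidence attached): for R-invariant Gibbs μ the class is closed under ν↦ν(·∘R) (R: p↦−p; 𝒜(f∘R) = −(𝒜f)∘R); R keeps ν(p_x²), negates ν(j_0); (ii) gives slope s≠0, (i) for ν and ν∘R gives κs = −κs with κ>0: contradiction. Needs only ∃ Gibbs state.
sources: Mclennan1959, MaesNetocny2010, BonettoLebowitzReyBellet2000, Bernardin2014, KunduDharNarayan2009, AokiLukkarinenSpohn2006
[crux] (Λ₁ CONSTITUTIVE LAW ON THE PLANE; card 'LadderAlgebra' + '(Λ₁)-existence ⟺ Green–Kubo' + 'κ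
= −current/slope'.) For ω₂, lam, β > 0, T > 0 and any Gibbs state μ at T there is κ = κ(T) > 0 such
that (i) for EVERY linear, first-order-stationary, linear-growth functional ν (same three hypotheses
as PlaneLiouville) the bond current equals −κ times the kinetic-temperature slope: ν(j_0) = −κ
(ν(p_1²) − ν(p_0²)), j_0 = bondCurrentZ σ 0; and (ii) SOME such ν has ν(p_1²) ≠ ν(p_0²). Since
ν∘shift is again in the class and ν(j_x) = ν(j_0) (stationarity against the site energies), (i)
makes the kinetic profile x ↦ ν(p_x²) of every ν ∈ 𝓗_1 exactly affine with slope −ν(j_0)/κ; (i)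
restricted to zero slope is 'no current without a temperature slope' on 𝓗_1 (odd rigidity one storey
up; false at lam = β = 0: SpohnLebowitz1977 current-carrying states); (ii) is existence of the
McLennan–Zubarev first-order state ν_1 = ν_lin + W_odd, equivalent to existence of the
time-integrated current corrector in local L²(μ_T) (Abelian, observable-wise Green–Kubo), and then κ
= −ν_1(j_0)/slope = κ_GK(T) (BLR (37)): κ_BLR = κ_GK is built into the plane. [difficulty:
open-problem] -/
@[route_item "route-AtomisticToContinuum-LiouvilleLadder"]
def SlopeCurrentLaw : Prop :=
  ∀ ω₂ lam β γ : ℝ, 0 < ω₂ → 0 < lam → 0 < β → ∀ T : ℝ, 0 < T → ∀ μ : MeasureTheory.Measure Literature.MathematicalPhysics.KineticTheory.HeatConduction.ChainConfig, (Literature.MathematicalPhysics.KineticTheory.HeatConduction.pinnedChain ω₂ lam β γ).IsChainGibbsMeasure T μ → ∃ κ : ℝ, 0 < κ ∧ (∀ ν : (Literature.MathematicalPhysics.KineticTheory.HeatConduction.ChainConfig → ℝ) → ℝ, (∀ (f g : Literature.MathematicalPhysics.KineticTheory.HeatConduction.ChainConfig → ℝ) (a b : ℝ), ν (fun σ =>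 a * f σ + b * g σ) = a * ν f + b * ν g) → (∀ f : Literature.MathematicalPhysics.KineticTheory.HeatConduction.ChainConfig → ℝ, Literature.Barriers.AtomisticToContinuum.HeatConduction.IsLocalTestFunction f → ν ((Literature.MathematicalPhysics.KineticTheory.HeatConduction.pinnedChain ω₂ lam β γ).liouvilleZ f) = 0) → (∀ n : ℕ, ∃ C : ℝ, ∀ (a : ℤ) (g : (Fin (n + 1) → ℝ × ℝ) → ℝ), ContDiff ℝ 1 g → MeasureTheory.Integrable (fun σ => (g (Literature.Barriers.AtomisticToContinuum.HeatConduction.boxRestrictAt a n σ)) ^ 2) μ → |ν (g ∘ Literature.Barriers.AtomisticToContinuum.HeatConduction.boxRestrictAt a n)| ≤ C * (1 + |(a : ℝ)|) * Real.sqrt (∫ σ, (g (Literature.Barriers.AtomisticToContinuum.HeatConduction.boxRestrictAt a n σ)) ^ 2 ∂μ)) → ν (fun σ => (Literature.MathematicalPhysics.KineticTheory.HeatConduction.pinnedChain ω₂ lam β γ).bondCurrentZ σ 0) = -(κ * (ν (fun σ => (σ 1).2 ^ 2) - ν (fun σ => (σ 0).2 ^ 2)))) ∧ ∃ ν : (Literature.MathematicalPhysics.KineticTheory.HeatConduction.ChainConfig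 → ℝ) → ℝ, (∀ (f g : Literature.MathematicalPhysics.KineticTheory.HeatConduction.ChainConfig → ℝ) (a b : ℝ), ν (fun σ => a * f σ + b * g σ) = a * ν f + b * ν g) ∧ (∀ f : Literature.MathematicalPhysics.KineticTheory.HeatConduction.ChainConfig → ℝ, Literature.Barriers.AtomisticToContinuum.HeatConduction.IsLocalTestFunction f → ν ((Literature.MathematicalPhysics.KineticTheory.HeatConduction.pinnedChain ω₂ lam β γ).liouvilleZ f) = 0) ∧ (∀ n : ℕ, ∃ C : ℝ, ∀ (a : ℤ) (g : (Fin (n + 1) → ℝ × ℝ) → ℝ), ContDiff ℝ 1 g → MeasureTheory.Integrable (fun σ => (g (Literature.Barriers.AtomisticToContinuum.HeatConduction.boxRestrictAt a n σ)) ^ 2) μ → |ν (g ∘ Literature.Barriers.AtomisticToContinuum.HeatConduction.boxRestrictAt a n)| ≤ C * (1 + |(a : ℝ)|) * Real.sqrt (∫ σ, (g (Literature.Barriers.AtomisticToContinuum.HeatConduction.boxRestrictAt a n σ)) ^ 2 ∂μ)) ∧ ν (fun σ => (σ 1).2 ^ 2) ≠ ν (fun σ => (σ 0).2 ^ 2)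

/-- item stmt-AtomisticToContinuum-4429 · crux · rank 4 · closed · moot by None · by planner
why it might fail: No engine: bulk stationarity constrains the even (profile) and odd (current) parts of W_N separately (reversibility), so the law needs time-asymmetric global input; no N-uniform retarded-response estimate exists; increments may stay non-uniform or D_N→0 faster; false at lam=β=0.
sources: BonettoLebowitzReyBellet2000, AvellanedaLin1987, ArmstrongKuusiMourrat2019, AokiKusnezov2000, LepriLiviPoliti2003, Dhar2008
[crux] (FINITE-N SHADOW OF Λ₁ — the bulk law WITH EQUALITY; output of the excess-decay engine, card
crux 3.) For pinnedChain ω₂ lam β γ (all four > 0), under weak-NESS uniqueness, along any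
steady-state family μ_{N,T_L,T_R} and every T > 0 there is κ = κ(T) > 0 such that for every ε > 0
there are a contact depth b and N₀ with: for all N ≥ N₀, every response coefficient d = D_N =
lim_{δ→0} totalCurrent(μ_{N,T+δ/2,T−δ/2})/δ and every kinetic-temperature response profile θ(i) =
lim_{δ→0} (μ_{N,T+δ/2,T−δ/2}(p_i²) − μ_{N,T,T}(p_i²))/δ, at every BULK bond (i, i+1) with b ≤ i ≤
N−2−b: |θ(i+1) − θ(i) + d/((N−1)κ)| ≤ ε (|d| + 1)/(N−1). In words: g_N = D_N/(N−1) being the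
per-bond current response, the profile increments equal −g_N/κ up to a relative error that is
uniform over the bulk and → 0 as the excluded contact depth grows — Fourier's law j = −κ∇T holding
locally, with equality and one κ, in linear response. Mechanism (layer 2, declared): normalised
recentred responses (W_N − θ_N(x)·shift)/g_N on bulk windows are precompact under N-uniform growth
bounds (from TopScaleBound by excess decay) and every limit lies in 𝓗_1(ℤ) with unit current, so
SlopeCurrentLaw forces increments → −1/κ (co -/
@[route_item "route-AtomisticToContinuum-LiouvilleLadder"]
def LocalFourierEquality : Prop :=
  ∀ ω₂ lam β γ : ℝ, 0 < ω₂ → 0 < lam → 0 < β → 0 < γ → (∀ (N : ℕ) (T_L T_R : ℝ), 0 < T_L → 0 < T_R → ∀ μ ν : MeasureTheory.Measure (Literature.MathematicalPhysics.KineticTheory.HeatConduction.PhaseSpace N), (Literature.MathematicalPhysics.KineticTheory.HeatConduction.pinnedChain ω₂ lam β γ).IsSteadyState N T_L T_R μ → (Literature.MathematicalPhysics.KineticTheory.HeatConduction.pinnedChain ω₂ lam β γ).IsSteadyState N T_L T_R ν → μ = ν) → ∀ μ : (N : ℕ) → ℝ → ℝ → MeasureTheory.Measure (Literature.MathematicalPhysics.KineticTheory.HeatConduction.PhaseSpace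 N), (∀ (N : ℕ) (T_L T_R : ℝ), 0 < T_L → 0 < T_R → (Literature.MathematicalPhysics.KineticTheory.HeatConduction.pinnedChain ω₂ lam β γ).IsSteadyState N T_L T_R (μ N T_L T_R)) → ∀ T : ℝ, 0 < T → ∃ κ : ℝ, 0 < κ ∧ ∀ ε : ℝ, 0 < ε → ∃ b N₀ : ℕ, ∀ (N : ℕ) (d : ℝ) (θ : Fin N → ℝ), N₀ ≤ N → Filter.Tendsto (fun δ : ℝ => (Literature.MathematicalPhysics.KineticTheory.HeatConduction.pinnedChain ω₂ lam β γ).totalCurrent (μ N (T + δ / 2) (T - δ / 2)) / δ) (nhdsWithin 0 {(0 : ℝ)}ᶜ) (nhds d) → (∀ i : Fin N, Filter.Tendsto (fun δ : ℝ => ((∫ x, (x.2 i) ^ 2 ∂(μ N (T + δ / 2) (T - δ / 2))) - ∫ x, (x.2 i) ^ 2 ∂(μ N T T)) / δ) (nhdsWithin 0 {(0 : ℝ)}ᶜ) (nhds (θ i))) → ∀ i j : Fin N, j.val = i.val + 1 → b ≤ i.val → j.val + b + 1 ≤ N → |θ j - θ i + d / (((N : ℝ) - 1) * κ)| ≤ ε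 * ((|d| + 1) / ((N : ℝ) - 1))

/-- item stmt-AtomisticToContinuum-4430 · crux · rank 5 · closed · moot by None · by planner
why it might fail: Provability rather than truth: at fixed N the only a-priori control is entropy production O(δ²) with no N-uniform Poincaré constant behind it (spectral gap ≲ γ/N, BeckerMenegaki2022); a proof needs one-body marginals within O(δ) of Gibbs uniformly in N (an LTE statement), itself open.
sources: EckmannPilletReyBellet1999b, BeckerMenegaki2022, CuneoEckmannHairerReyBellet2018, HairerMajda2009, BonettoLebowitzReyBellet2000
[crux] (TOP-SCALE A-PRIORI ESTIMATE; card crux 2.) For pinnedChain (all four parameters > 0), under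
weak-NESS uniqueness, along any steady-state family and every T > 0 there is C with: for every N,
for all δ ≠ 0 small enough (depending on N), μ_{N,T+δ/2,T−δ/2} ≪ μ_{N,T,T} and ∫
(dμ_{N,T+δ/2,T−δ/2}/dμ_{N,T,T})² dμ_{N,T,T} ≤ 1 + C(N+1)δ² — i.e. χ²(NESS_δ ‖ NESS_0) = O(δ²N): the
NESS is EXTENSIVELY (not super-extensively) distinguishable from equilibrium to second order,
equivalently the linear-response density W_N = ∂_δ(dμ_δ/dμ_0)|₀ has ‖W_N‖²_{L²(μ_{N,T,T})} ≤ C(N+1).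
Stated junk-free with the lower Lebesgue integral of rnDeriv². Local equilibrium predicts χ² ≈ δ²
Σ_i θ_N(i)² c_v/T² ≍ δ²N with an odd (current) part O(δ²/N). Role: the a-priori bound at scale N
from which excess decay propagates O(g_N)-accuracy down to windows of size R₀ (layer 2: growth
bounds for LocalFourierEquality and KapitzaBound). N = 0, 1: both states coincide (point mass;
single site thermalised at (T_L+T_R)/2 = T), χ² = 0. [difficulty: L] -/
@[route_item "route-AtomisticToContinuum-LiouvilleLadder"]
def TopScaleBound : Prop :=
  ∀ ω₂ lam β γ : ℝ, 0 < ω₂ → 0 < lam → 0 < β → 0 < γ → (∀ (N : ℕ) (T_L T_R : ℝ), 0 < T_L → 0 < T_R → ∀ μ ν : MeasureTheory.Measure (Literature.MathematicalPhysics.KineticTheory.HeatConduction.PhaseSpace N), (Literature.MathematicalPhysics.KineticTheory.HeatConduction.pinnedChain ω₂ lam β γ).IsSteadyState N T_L T_R μ → (Literature.MathematicalPhysics.KineticTheory.HeatConduction.pinnedChain ω₂ lam β γ).IsSteadyState N T_L T_R ν → μ = ν) → ∀ μ : (N : ℕ) → ℝ → ℝ → MeasureTheory.Measure (Literature.MathematicalPhysics.KineticTheory.HeatConduction.PhaseSpace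 N), (∀ (N : ℕ) (T_L T_R : ℝ), 0 < T_L → 0 < T_R → (Literature.MathematicalPhysics.KineticTheory.HeatConduction.pinnedChain ω₂ lam β γ).IsSteadyState N T_L T_R (μ N T_L T_R)) → ∀ T : ℝ, 0 < T → ∃ C : ℝ, ∀ N : ℕ, ∀ᶠ δ : ℝ in nhdsWithin 0 {(0 : ℝ)}ᶜ, MeasureTheory.Measure.AbsolutelyContinuous (μ N (T + δ / 2) (T - δ / 2)) (μ N T T) ∧ ∫⁻ x, ((μ N (T + δ / 2) (T - δ / 2)).rnDeriv (μ N T T) x) ^ 2 ∂(μ N T T) ≤ ENNReal.ofReal (1 + C * ((N : ℝ) + 1) * δ ^ 2)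

/-- item stmt-AtomisticToContinuum-4431 · crux · rank 6 · closed · moot by None · by planner
why it might fail: Contact layers have width ~ mean free path ~(lam T)⁻² and the kinetic temperature near a Langevin bath deviates from other local temperatures (AokiKusnezov2001 boundary jumps); a finite but huge C_b at low T is fine, an N-growing contact deviation (anomalous contact resistance) is not.
sources: AokiKusnezov2001, LepriLiviPoliti2003, Dhar2008, EckmannPilletReyBellet1999b, doi:10.1137/16m1070384
[crux] (CONTACT LAYERS = BOUNDARY REGULARITY; the (Λ₀/Λ₁, half-line) rungs in finite-N form.) For
pinnedChain (all four > 0), under weak-NESS uniqueness, along any steady-state family, every T > 0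
and every contact depth b there are C = C_b and N₀ such that for all N ≥ N₀, every response
coefficient d = D_N and kinetic response profile θ (as in LocalFourierEquality): |θ(i) − 1/2| ≤
C(|d| + 1)/(N−1) for the sites i ≤ b, and |θ(i) + 1/2| ≤ C(|d| + 1)/(N−1) for the sites i ≥ N−1−b.
In words: the first/last b+1 kinetic temperatures sit within O(current + 1/N) of the bath
perturbations ±1/2 — a bounded Kapitza (contact) resistance plus bounded growth across the contact
layer. At the bath sites this is the exact identity γ(1/2 − θ(0)) = g_N = γ(θ(N−1) + 1/2) (energy
balance J = γ(T_L − ⟨p_0²⟩), EckmannPilletReyBellet1999b/BLR (25)–(27), differentiated at δ = 0);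
across the layer it is the boundary analogue of the growth bounds (dictionary: Avellaneda–Lin
boundary Lipschitz estimate; mechanism: 𝓗_0(ℕ, bath) = 0 and 𝓗_1(ℕ, bath) one-dimensional — the
single-thermostat rung — plus compactness). Holds trivially in the ballistic corner (θ bounded, g_N
= O(1)); its content is for g_N → 0. [dep -/
@[route_item "route-AtomisticToContinuum-LiouvilleLadder"]
def KapitzaBound : Prop :=
  ∀ ω₂ lam β γ : ℝ, 0 < ω₂ → 0 < lam → 0 < β → 0 < γ → (∀ (N : ℕ) (T_L T_R : ℝ), 0 < T_L → 0 < T_R → ∀ μ ν : MeasureTheory.Measure (Literature.MathematicalPhysics.KineticTheory.HeatConduction.PhaseSpace N), (Literature.MathematicalPhysics.KineticTheory.HeatConduction.pinnedChain ω₂ lam β γ).IsSteadyState N T_L T_R μ → (Literature.MathematicalPhysics.KineticTheory.HeatConduction.pinnedChain ω₂ lam β γ).IsSteadyState N T_L T_R ν → μ = ν) → ∀ μ : (N : ℕ) → ℝ → ℝ → MeasureTheory.Measure (Literature.MathematicalPhysics.KineticTheory.HeatConduction.PhaseSpace N), (∀ (N : ℕ) (T_L T_R : ℝ), 0 < T_L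 → 0 < T_R → (Literature.MathematicalPhysics.KineticTheory.HeatConduction.pinnedChain ω₂ lam β γ).IsSteadyState N T_L T_R (μ N T_L T_R)) → ∀ T : ℝ, 0 < T → ∀ b : ℕ, ∃ (C : ℝ) (N₀ : ℕ), ∀ (N : ℕ) (d : ℝ) (θ : Fin N → ℝ), N₀ ≤ N → Filter.Tendsto (fun δ : ℝ => (Literature.MathematicalPhysics.KineticTheory.HeatConduction.pinnedChain ω₂ lam β γ).totalCurrent (μ N (T + δ / 2) (T - δ / 2)) / δ) (nhdsWithin 0 {(0 : ℝ)}ᶜ) (nhds d) → (∀ i : Fin N, Filter.Tendsto (fun δ : ℝ => ((∫ x, (x.2 i) ^ 2 ∂(μ N (T + δ / 2) (T - δ / 2))) - ∫ x, (x.2 i) ^ 2 ∂(μ N T T)) / δ) (nhdsWithin 0 {(0 : ℝ)}ᶜ) (nhds (θ i))) → ∀ i : Fin N, (i.val ≤ b → |θ i - 1 / 2| ≤ C * ((|d| + 1) / ((N : ℝ) - 1))) ∧ (N ≤ i.val + b + 1 → |θ i + 1 / 2| ≤ C * ((|d| + 1) / ((N : ℝ) - 1)))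

/-- item stmt-AtomisticToContinuum-0717 · support · rank 9 · closed · proved by Summit.AtomisticToContinuum.FouriersLaw.Theorems.FourierGreenKubo.finiteResponseOfUnique_holds (prover) · by planner
sources: HairerMajda2009, ReyBellet2003, CuneoEckmannHairerReyBellet2018
CONDITIONAL FORM OF 0705 (supersedes it as the prover target; refuters pool-5/g3-0: 0705 stand-alone
quantifies over EVERY steady-state family and is false-prone if weak steady states were non-unique):
assuming UNIQUENESS of weak steady states (IsSteadyState class) for pinnedChain at all N, T_L, T_R >
0, the finite-N linear-response limit D_N(T) = lim_{δ→0, δ≠0} totalCurrent(μ_{N,T+δ/2,T−δ/2})/δ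
exists for every T > 0 and N. Content: differentiability at equilibrium of NESS expectations of the
polynomial currents in the bath temperatures (ReyBellet2003 arXiv:math-ph/0303021 Rem 4.4 (51)–(56)
finite-volume Green–Kubo; HairerMajda2009 arXiv:0909.4313 Thm 2.3 framework — their SDE Thm 4.4
Assumption 5 fails here, so verify Assumptions 1–3 via CEHR2018 (2.5)/Carmona2007 Thm 1.1(iv)
weighted spectral gap). N = 0, 1: totalCurrent ≡ 0, D = 0. Together with 0706 gives 0705. -/
@[route_item "route-AtomisticToContinuum-LiouvilleLadder"]
def FiniteResponseOfUnique : Prop :=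
  ∀ ω₂ lam β γ : ℝ, 0 < ω₂ → 0 < lam → 0 < β → 0 < γ → (∀ (N : ℕ) (T_L T_R : ℝ), 0 < T_L → 0 < T_R → ∀ μ ν : MeasureTheory.Measure (Literature.MathematicalPhysics.KineticTheory.HeatConduction.PhaseSpace N), (Literature.MathematicalPhysics.KineticTheory.HeatConduction.pinnedChain ω₂ lam β γ).IsSteadyState N T_L T_R μ → (Literature.MathematicalPhysics.KineticTheory.HeatConduction.pinnedChain ω₂ lam β γ).IsSteadyState N T_L T_R ν → μ = ν) → ∀ μ : (N : ℕ) → ℝ → ℝ → MeasureTheory.Measure (Literature.MathematicalPhysics.KineticTheory.HeatConduction.PhaseSpace N), (∀ (N : ℕ) (T_L T_R : ℝ), 0 < T_L → 0 < T_R → (Literature.MathematicalPhysics.KineticTheory.HeatConduction.pinnedChain ω₂ lam β γ).IsSteadyState N T_L T_R (μ N T_L T_R)) → ∀ T : ℝ, 0 < T → ∀ N : ℕ, ∃ D : ℝ, Filter.Tendsto (fun δ : ℝ => (Literature.MathematicalPhysics.KineticTheory.HeatConduction.pinnedChain ω₂ lam β γ).totalCurrent (μ N (T + δ / 2) (T -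 δ / 2)) / δ) (nhdsWithin 0 {(0 : ℝ)}ᶜ) (nhds D)

/-- item stmt-AtomisticToContinuum-0741 · support · rank 9 · closed · proved by Summit.AtomisticToContinuum.FouriersLaw.Theorems.nessUnique_proof (prover) · by planner
sources: CuneoEckmannHairerReyBellet2018, BonettoLebowitzReyBellet2000
[crux] UNIQUENESS OF THE WEAK STEADY STATE (the half of stmt-0706 not covered by the landed fact
Literature.MathematicalPhysics.KineticTheory.HeatConduction.CuneoEckmannHairerReyBellet2018_pinnedChain,
p3544): for pinnedChain ω₂ lam β γ (all > 0), every N and T_L, T_R > 0, any two measures in the weak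
Fokker–Planck class IsSteadyState (probability, ∫ L f dμ = 0 for f ∈ C_c^∞, bond currents
integrable) coincide. Print: uniqueness of the INVARIANT MEASURE of the Langevin semigroup
(CuneoEckmannHairerReyBellet2018 Thm 2.13(1): C1, C2, CA; Carmona2007 Thm 1.1(iii)); the item
additionally needs 'weak stationary probability solution of L*μ = 0 ⇒ P_t-invariant' for this
hypoelliptic L with cubic drift (Echeverría 1982 well-posed martingale problem on C_c^∞ +
non-explosion via e^{θH}; Bogachev–Krylov–Röckner–Shaposhnikov 2015 Ch. 5 is non-degenerate only) —
the FP-identification lemma is the formal crux. N = 0: PhaseSpace 0 is a point (unique probability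
measure); N = 1: both baths on site 0, OU at temperature (T_L+T_R)/2. This is exactly the hypothesis
of FiniteResponse and ThermodynamicLimit and, with the fact, gives clause (i) of FouriersLawFor. -/
@[route_item "route-AtomisticToContinuum-LiouvilleLadder"]
def NessUnique : Prop :=
  ∀ ω₂ lam β γ : ℝ, 0 < ω₂ → 0 < lam → 0 < β → 0 < γ → ∀ (N : ℕ) (T_L T_R : ℝ), 0 < T_L → 0 < T_R → ∀ μ ν : MeasureTheory.Measure (Literature.MathematicalPhysics.KineticTheory.HeatConduction.PhaseSpace N), (Literature.MathematicalPhysics.KineticTheory.HeatConduction.pinnedChain ω₂ lam β γ).IsSteadyState N T_L T_R μ → (Literature.MathematicalPhysics.KineticTheory.HeatConduction.pinnedChain ω₂ lam β γ).IsSteadyState N T_L T_R ν → μ = ν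

/-- `NessUnique` holds: proved by `Summit.AtomisticToContinuum.FouriersLaw.Theorems.nessUnique_proof`. -/
theorem NessUnique_holds : NessUnique := _root_.Summit.AtomisticToContinuum.FouriersLaw.Theorems.nessUnique_proof

/-- item stmt-AtomisticToContinuum-2742 · support · rank 9 · closed · moot by None · by planner
sources: HairerMajda2009, ReyBellet2003, BonettoLebowitzReyBellet2000
[support] EXISTENCE OF THE KINETIC-TEMPERATURE RESPONSE PROFILE: under weak-NESS uniqueness, for
every steady-state family, T > 0, N and site i, δ ↦ (μ_{N,T+δ/2,T−δ/2}(p_i²) − μ_{N,T,T}(p_i²))/δ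
has a limit θ_N(i) as δ → 0, δ ≠ 0 — the same differentiability-at-equilibrium content as
FiniteResponseOfUnique, for the polynomial observable p_i² instead of the bond currents (one
Hairer–Majda/Rey-Bellet argument proves both; p_i² is integrable under the true NESS since e^{ϑH}
is, CEHR2018 Thm 2.13(2)). Needed to instantiate θ_N in LocalOhm/BVProfile. N = 0: no sites.
Sources: HairerMajda2009 Thm 2.3; ReyBellet2003 Rem 4.4; BonettoLebowitzReyBellet2000 §6.3 (34)
(real-analyticity in δT, EPR reservoirs). -/
@[route_item "route-AtomisticToContinuum-LiouvilleLadder"]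
def FiniteResponseProfile : Prop :=
  ∀ ω₂ lam β γ : ℝ, 0 < ω₂ → 0 < lam → 0 < β → 0 < γ → (∀ (N : ℕ) (T_L T_R : ℝ), 0 < T_L → 0 < T_R → ∀ μ ν : MeasureTheory.Measure (Literature.MathematicalPhysics.KineticTheory.HeatConduction.PhaseSpace N), (Literature.MathematicalPhysics.KineticTheory.HeatConduction.pinnedChain ω₂ lam β γ).IsSteadyState N T_L T_R μ → (Literature.MathematicalPhysics.KineticTheory.HeatConduction.pinnedChain ω₂ lam β γ).IsSteadyState N T_L T_R ν → μ = ν) → ∀ μ : (N : ℕ) → ℝ → ℝ → MeasureTheory.Measure (Literature.MathematicalPhysics.KineticTheory.HeatConduction.PhaseSpace N), (∀ (N : ℕ) (T_L T_R : ℝ), 0 < T_L → 0 < T_R → (Literature.MathematicalPhysics.KineticTheory.HeatConduction.pinnedChain ω₂ lam β γ).IsSteadyState N T_L T_R (μ N T_L T_R)) → ∀ T : ℝ, 0 < T → ∀ (N : ℕ) (i : Fin N), ∃ t : ℝ, Filter.Tendsto (fun δ : ℝ => ((∫ x, (x.2 i) ^ 2 ∂(μ N (T + δ / 2) (T - δ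 / 2))) - ∫ x, (x.2 i) ^ 2 ∂(μ N T T)) / δ) (nhdsWithin 0 {(0 : ℝ)}ᶜ) (nhds t)

/-- item stmt-AtomisticToContinuum-4432 · assembly · rank 1 · closed · moot by None · by planner
sources: BonettoLebowitzReyBellet2000, CuneoEckmannHairerReyBellet2018
[assembly] NessUnique → FiniteResponseOfUnique → FiniteResponseProfile → TopScaleBound →
PlaneLiouville → SlopeCurrentLaw → KapitzaBound → LocalFourierEquality → FouriersLaw (the conjunct,
= Literature.MathematicalPhysics.KineticTheory.HeatConduction.FouriersLaw). -/
@[route_item "route-AtomisticToContinuum-LiouvilleLadder"]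
def Assembly : Prop :=
  NessUnique → FiniteResponseOfUnique → FiniteResponseProfile → TopScaleBound → PlaneLiouville → SlopeCurrentLaw → KapitzaBound → LocalFourierEquality → Literature.MathematicalPhysics.KineticTheory.HeatConduction.FouriersLaw

end Summit.AtomisticToContinuum.FouriersLaw.Theses.LiouvilleLadder
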